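import Literature.NumberTheory.Kottwitz1992.Polarizations
import Literature.AlgebraicGeometry.AbelianSchemes.AbelianSchemePolarization
import Literature.AlgebraicGeometry.AbelianSchemes.AbelianSchemeDualIsogeny
import HarnessLib

/-!
# Kottwitz 1992 §9 — the bridge from the posited `DualityData` of ★ `Kottwitz1992/Polarizations` to the tree's
# scheme-level duality: ★ `AbelianSchemes.DualPair`, ★ `AbelianSchemePolarization.Polarization`, ★ `dualIsogenyOver`

Squad TK, seat TK-t04, DEAL v4 (P-b): T-ref1's NB-1 on ★ `Polarizations.lean` (02:19:26Z) — «`DualityData` (hat,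
hatMap, bidual, phi) is a VARIETY-level parallel of the scheme-level ★ `AbelianSchemes.DualPair` ∕ ★
`AbelianSchemePolarization.Polarization (D : A.DualPair)` ∕ ★ `IsLambdaOfAt` — the file records the dictionary … bridge
owed».  This module IS that dictionary, as ONE structure with data fields and equations (definitions only: no named
fact, no theorem, no instance, no notation).  It is a SIBLING module rather than an edition of `Polarizations.lean` so
that the carpet keeps its light import closure (★ `AbelianSchemePolarization` pulls the line-bundle ∕ GAGA stack).

## The dictionary (for `k` a field, `A : AbelianVariety k`, `𝒜 := AbelianSchemeOver.ofAbelianVariety A`, whose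
## underlying `k`-group scheme is `A.X` on the nose)

A `SchemeWitness D` for a duality datum `D : DualityData k` consists of
* `pair A : 𝒜.DualPair` — a Milne ∕ [MFK] dual pair `(Â, 𝒫)` of the abelian scheme `𝒜` (★ `AbelianSchemeDualPair`:
  rigidified Poincaré family + universal property);
* `hatIso A : (pair A).hat ≅ D.hat A` as abelian varieties over `k` (the scheme-level dual, read back through
  ★ `AbelianSchemeOver.toAffine` ∕ ★ `AbelianScheme.toAbelianVariety`, IS the posited `Â`);
* `phi_eq` — for an ample Cartier divisor `Θ` on `A`, the posited `φ_{𝒪(Θ)} : A → Â` IS (through `hatIso`) the `λ` of an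
  [MFK] Def. 6.3 polarization of `𝒜` for `pair A` (★ `Polarization`: an `S`-homomorphism with `λ̄ = Λ(L̄)`, `L̄` ample,
  at every geometric point — [MumfordAV1970] §6 Cor. 4 / §13: `Λ(L)` for `L` ample is a polarization);
* `hatMap_eq` — for `f : A → B`, the posited `f̂ = D.hatMap f` IS (through `hatIso`) the DUAL HOMOMORPHISM
  ★ `DualPair.dualIsogenyOver f (pair A) (pair B) : B̂ → Â` classifying `(f × 1)^*𝒫_B` ([MumfordAV1970] §15 Thm. 1).
Not bridged here (recorded): the biduality `D.bidual` (the tree has no `Â̂ ≅ A` for dual pairs yet — owed leaf of the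
★ `AbelianSchemeDualPair` docstring), and the finer reading «`φ_{𝒪(Θ)}` is `Λ(𝒪(Θ))` ITSELF» (★ `IsLambdaOfAt` speaks of a
divisor on each geometric FIBRE; the class-level pull-back of `Θ` to the fibres is the route of ★
`AbelianVarieties/PolarizationOfAmpleDivisor`, `exists_polarization_of_dualPair`).  Consumers of Lemma 9.1 ∕ 9.2
(`Kottwitz1992_9_1_…`, `Kottwitz1992_9_2_…`, predicates on `D`) who want the scheme-level meaning carry
`(W : D.SchemeWitness)` alongside `D.IsLawful`.

## References
* [Kottwitz1992] §9 p. 401 («the functor `A ↦ Â`», `φ_ℒ`, «see [M2]»).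
* [MumfordAV1970] §13 (`Λ(L)`), §15 Thm. 1 (dual homomorphism); [MumfordFogartyKirwan1994] Ch. 6 §2 Def. 6.2–6.3.
* [MilneAV2008] I §8 (the dual as a universal pair), I §11 (polarizations).
-/

noncomputable section

open CategoryTheory

universe u

namespace Literature.NumberTheory.Kottwitz1992.Polarizations

open Literature.AlgebraicGeometry.Motives Literature.AlgebraicGeometry.Motives.AbelianVariety
open Literature.AlgebraicGeometry.AbelianSchemes

variable {k : Type u} [Field k]

namespace DualityData

/-- **Scheme-level witness for a posited duality datum** `D : DualityData k` (T-ref1 NB-1 on ★ `Polarizations`): for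
every abelian variety `A` over `k`, a dual pair `(Â, 𝒫)` of the abelian scheme `ofAbelianVariety A` (★ `DualPair`)
together with an isomorphism of abelian varieties `Â ≅ D.hat A`, under which (i) the posited `φ_{𝒪(Θ)}` (`Θ` ample)
is the `λ` of an [MFK] polarization (★ `Polarization`), and (ii) the posited `f̂` is the dual homomorphism
(★ `DualPair.dualIsogenyOver`).  Data + equations only; nothing is asserted to exist.
[cite: Kottwitz1992, §9 (p. 401)] [cite: MumfordFogartyKirwan1994, Ch. 6 §2 Definition 6.3 (p. 120)]
[cite: MumfordAV1970, §15 Thm. 1 (p. 143)] -/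
structure SchemeWitness (D : DualityData k) where
  /-- a dual pair `(Â, 𝒫)` of the abelian scheme `A / Spec k`, for every `A` -/
  pair : ∀ A : AbelianVariety k, (AbelianSchemeOver.ofAbelianVariety A).DualPair
  /-- the scheme-level dual, as an abelian variety over `k`, is the posited `Â` -/
  hatIso : ∀ A : AbelianVariety k, (pair A).hat.toAffine.toAbelianVariety ≅ D.hat A
  /-- `φ_{𝒪(Θ)}` for `Θ` ample is (through `hatIso`) the `λ` of an [MFK] Def. 6.3 polarization for `pair A` -/
  phi_eq : ∀ (A : AbelianVariety k) [AlgebraicGeometry.IsIntegral A.X.left] (Θ : CartierDivisor A.X.left),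
    Θ.IsAmple → ∃ pol : (AbelianSchemeOver.ofAbelianVariety A).Polarization (pair A),
      pol.lam ≫ (hatIso A).hom.hom.hom.hom = (D.phi Θ).hom.hom.hom
  /-- `f̂` is (through `hatIso`) the dual homomorphism `B̂ → Â` classifying `(f × 1)^*𝒫_B` -/
  hatMap_eq : ∀ {A B : AbelianVariety k} (f : A ⟶ B),
    (hatIso B).inv.hom.hom.hom ≫
        @AbelianSchemeOver.DualPair.dualIsogenyOver _ (AbelianSchemeOver.ofAbelianVariety A)
          (AbelianSchemeOver.ofAbelianVariety B) f.hom.hom.hom f.hom.hom.isMonHom_hom (pair A) (pair B) ≫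
      (hatIso A).hom.hom.hom.hom = (D.hatMap f).hom.hom.hom

end DualityData

end Literature.NumberTheory.Kottwitz1992.Polarizations
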